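import Summits.BirchSwinnertonDyer.Rank1Residual.Additive.RamifiedOrdinaryLineHalfPower
import Summits.BirchSwinnertonDyer.Rank1Residual.Additive.GordHigherCongruentPairGVOfS2
import Summits.BirchSwinnertonDyer.Rank1Residual.Additive.GordHigherCongruentPairGV
import HarnessLib

/-!
# The μ-ANCHOR BRICK on the EQUAL-PARITY swap locus: Greenberg–Vatsal count, `μ = 0` transfer,
# `λ^{Σ₀}` equality and `CongruentLambdaShift` on Gord_e346 × Gord_e346 congruence links with BOTH
# members line-even — `e_i` even, `e_i ≠ 2`, `(p−1)/e_i` odd: the (5;4,4) and (7;6,6) links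
# (cell `b2b-bsdres`, team n1011, seat p07 (gen 8); r2 §II.27 T2 of the ARM α e346 package
# T1/T2/T3, lead R5-71 (i); consumer of row T-ROL-ORD's F4 lane = p16's `RamifiedOrdinaryLineHalfPower`)

HONEST FRAMING (cell `b2b-bsdres`, run/shared/lean/b2b/bsd-rank1-residual/, verbatim in every
file): the goal of the cell is to DELETE the COMBINATION-SHAPED residual classes of the
Birch–Swinnerton-Dyer formula for ALL analytic-rank `≤ 1` elliptic curves over `ℚ` — "full BSD
formula for every rank `≤ 1` curve in class `C`" assembled STRICTLY from published theorems — so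
that the rank-`≤ 1` remainder becomes exactly the CONSTRUCTION-SHAPED classes, which are TYPED
(missing-input `Prop`s), NOT attempted. This is not "finishing BSD". Team n1011 (N10/N11, the (G-ord)
rows of defect `e ∈ {4, 6}`): research route; labels and marks UNCHANGED; nothing booked. TOOL
theorems only: NO definition, NO named fact; NOT budget nodes (r2 II.27.6). CONDITIONAL exactly as
the consumed files: §1–§2 carry the R-D identifications `hRD₁`, `hRD₂` (`RamifiedLineKummerEqAt`) as
EXPLICIT binders and the GV record `hGV` (A240 — `= …_of_records h23 h414`, p12 K4 FINAL) where the
λ-reading needs it; §3 discharges `hRD_i` mod cc-typer-2's S2 record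
(`imKummer_ge_strictCondition_goodOrdinaryModel`, p05 K5 via `ramifiedLineKummerEqAt_of_s2_of_typeGOrd`).

## What and why

Row T-ROL-EXP (gen 7) typed the GV transfer on Gord × Gord links of any defects OFF the swap locus
`(p−1) ∣ lcm(e₁, e₂)` (files C/D/D2/F: matching by cc-typer-2's S3 + exponents). ON the locus,
cc-typer-2's S4 (`exists_lines_matching_of_lineHalfPow`, p291619) matches the lines of two LINE-EVEN
curves, and row T-ROL-ORD's F4 lane (p16's `IsRamifiedOrdinaryLine.lineHalfPow_of_typeGOrd_of_even`,
`exists_lines_matching_of_typeGOrd_of_even`, `inclusion_mem_iff_of_typeGOrd_of_even`) proves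
line-evenness on every (G-ord) row with `e` even, `e ≠ 2`, `(p−1)/e` odd — cc-typer-2's T6 receipt:
the (5;4,4) 297 + (7;6,6) 43 CONG links, every one an OPEN ↔ OPEN e346 pair; r2 II.27: the 6
'ANCHORED-PENDING' Route-2 rows {131100f1, 133350bm1, 233450cr1, 423150da1, 46200dg1, 499800el1}.
This file is r2's **T2**: the same consumer layer as T-ROL-EXP D/D2/F with `hlines` from the F4 lane.

* §0 `forall_exists_lines_matching_of_typeGOrd_of_even` — p12's `hlines` binder VERBATIM (`∀ v ∋ p`).
* §1 (p12 MF `…_of_matching`): `natCard_torsionBy_nonPrimitiveSelmerInfty_eq_of_typeGOrd_typeGOrd_of_even`,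
  `selmer_isTorsion_and_mu_eq_zero_…`, `nonPrimitive_lambdaInvariant_eq_…` (hRD₁ hRD₂ explicit).
* (part 2, `GordEvenCongruentPairGVShift`) §2 (cc-typer-2's schema `congruentLambdaShift_of_gv` / `mu_eq_zero_of_gv`):
  `congruentLambdaShift_of_gv_of_typeGOrd_typeGOrd_of_even`, `mu_eq_zero_of_gv_…` (hGV, hRD explicit).
* §3 all per-curve binders from records (hRD mod S2): `…_of_gv_of_s2_of_typeGOrd_typeGOrd_of_even` and
  the class forms `ClassX4Gord./ClassX3Gord.congruentLambdaShift_of_gv_of_s2_of_even`,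
  `….mu_eq_zero_of_gv_of_s2_of_even`.

NOT here: T1 (cc-typer-2, `TameBranchUpperOfRatDvd`), T3 (`X(E₁/ℚ_∞) = 0` by control, p12/p04), any
budget / END (the e346 Kato-direction input is construction-shaped), MIXED-parity links (dead by S4b),
`p = 3`, `e = 2`.

References: R. Greenberg, V. Vatsal, Invent. Math. 142 (2000) §2 Prop. (2.8), Remark (2.9), Cor. (2.3),
Prop. (2.4), pp. 26–27 [GreenbergVatsal2000]; R. Greenberg, LNM 1716 (1999) Prop. 2.4, Prop. 5.10
[GreenbergLNM1716]; M. Emerton, R. Pollack, T. Weston, Invent. Math. 163 (2006) pp. 2–3, §3.1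
[EmertonPollackWeston2006]; cells/n1011/ROUTE-2.md §II.27 (T2); class-closure/N10/TRANSPORT-TEMPLATE.md v2.1.
-/

set_option autoImplicit false

noncomputable section

open scoped Classical NumberField AddSubgroup

open NumberField IsDedekindDomain Field WeierstrassCurve
  Literature.NumberTheory.GaloisRepresentations Literature.NumberTheory.EllipticCurves
  Literature.NumberTheory.EllipticCurves.GreenbergSelmer
  Literature.NumberTheory.EllipticCurves.Greenberg1999
  Literature.NumberTheory.EllipticCurves.GreenbergVatsal2000
  Literature.NumberTheory.EllipticCurves.EmertonPollackWeston2006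
  Literature.NumberTheory.EllipticCurves.Rank1Residual
  Summit.BirchSwinnertonDyer.Rank1Residual.X2.TorsionComparison
  Summit.BirchSwinnertonDyer.Rank1Residual.X2.GreenbergVatsalTorsion

namespace Summit.BirchSwinnertonDyer.Rank1Residual.Additive

open Summit.BirchSwinnertonDyer.Rank1Residual.X1.CongruenceTransfer
open GordHigherCongruentPairGVShift GordHigherCongruentPairGVOfS2
open WeierstrassCurve (geomTorsion geomPrimaryTorsion geomTorsion_le_geomPrimaryTorsion)

namespace GordEvenCongruentPairGV

/-! ### §0 The `hlines` binder on the equal-parity swap locus -/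

section Lines

variable {p : ℕ} [hp : Fact p.Prime] {W₁ W₂ : WeierstrassCurve ℚ} [W₁.IsElliptic] [W₁.IsGloballyMinimal]
  [W₂.IsElliptic] [W₂.IsGloballyMinimal]

/-- **p12's `hlines` binder on a Gord × Gord link with BOTH members line-even** (`p ≥ 5`; `e_i` even,
`e_i ≠ 2`, `(p−1)/e_i` odd): at every `v ∋ p`, ramified ordinary lines matched by every
`Γ_ℚ`-equivariant `E₁[p] ≃+ E₂[p]` — the F4 lane's `exists_lines_matching_of_typeGOrd_of_even`
(p16, via cc-typer-2's S4) packaged `∀ v`. [cite: GreenbergVatsal2000, §2 p. 26 and Remark (2.9)]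
[cite: EmertonPollackWeston2006, pp. 2–3 and §3.1 (eq:ordes) (arXiv:math/0404484 p. 17)] -/
theorem forall_exists_lines_matching_of_typeGOrd_of_even (hp5 : 5 ≤ p)
    (hG₁ : TypeGOrd W₁ p) (hadd₁ : Addv W₁ p) (h2e₁ : 2 ∣ semistabilityIndex W₁ p)
    (he2₁ : semistabilityIndex W₁ p ≠ 2) (hodd₁ : ¬ 2 ∣ (p - 1) / semistabilityIndex W₁ p)
    (hG₂ : TypeGOrd W₂ p) (hadd₂ : Addv W₂ p) (h2e₂ : 2 ∣ semistabilityIndex W₂ p)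
    (he2₂ : semistabilityIndex W₂ p ≠ 2) (hodd₂ : ¬ 2 ∣ (p - 1) / semistabilityIndex W₂ p) :
    ∀ (v : HeightOneSpectrum (𝓞 ℚ)) (_ : ((p : ℕ) : 𝓞 ℚ) ∈ v.asIdeal),
      ∃ (L₁ : LocalDatum ℚ ↥(W₁.geomPrimaryTorsion p) v) (L₂ : LocalDatum ℚ ↥(W₂.geomPrimaryTorsion p) v),
        IsRamifiedOrdinaryLine W₁ p L₁ ∧ IsRamifiedOrdinaryLine W₂ p L₂ ∧
        ∀ e : ↥(geomTorsion W₁ (p : ℤ)) ≃+ ↥(geomTorsion W₂ (p : ℤ)),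
          (∀ (σ : absoluteGaloisGroup ℚ) (P : ↥(geomTorsion W₁ (p : ℤ))), e (σ • P) = σ • e P) →
          ∀ P : ↥(geomTorsion W₁ (p : ℤ)),
            AddSubgroup.inclusion (geomTorsion_le_geomPrimaryTorsion W₁ p) P ∈ L₁.plus ↔
              AddSubgroup.inclusion (geomTorsion_le_geomPrimaryTorsion W₂ p) (e P) ∈ L₂.plus :=
  fun _ hpv ↦ exists_lines_matching_of_typeGOrd_of_even hp5 hG₁ hadd₁ h2e₁ he2₁ hodd₁ hG₂ hadd₂ h2e₂
    he2₂ hodd₂ hpv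

end Lines

/-! ### §1 The GV count, `μ = 0` transfer and `λ^{Σ₀}` equality (p12's model-free count) -/

section Count

variable {p : ℕ} [hp : Fact p.Prime] {W₁ W₂ : WeierstrassCurve ℚ} [W₁.IsElliptic] [W₁.IsGloballyMinimal]
  [W₂.IsElliptic] [W₂.IsGloballyMinimal] (κ : ZpExtension ℚ p) {γ : absoluteGaloisGroup ℚ}
  (S₀ : Set (HeightOneSpectrum (𝓞 ℚ)))

/-- **GV p. 27 on a line-even Gord × Gord link** (`p ≥ 5`; both `e_i` even `≠ 2` with `(p−1)/e_i`
odd — the (5;4,4) / (7;6,6) links): `#Sel^{Σ₀}_{E₁}(ℚ_∞)_p[p] = #Sel^{Σ₀}_{E₂}(ℚ_∞)_p[p]`, modulo the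
R-D identifications `hRD₁`, `hRD₂`. p12's `natCard_torsionBy_nonPrimitiveSelmerInfty_eq_of_matching`
with §0. [cite: GreenbergVatsal2000, §2 Prop. (2.8), Remark (2.9) and pp. 26–27] -/
theorem natCard_torsionBy_nonPrimitiveSelmerInfty_eq_of_typeGOrd_typeGOrd_of_even (hp5 : 5 ≤ p)
    (hκ : κ.IsCyclotomic) (hG₁ : TypeGOrd W₁ p) (hadd₁ : Addv W₁ p) (h2e₁ : 2 ∣ semistabilityIndex W₁ p)
    (he2₁ : semistabilityIndex W₁ p ≠ 2) (hodd₁ : ¬ 2 ∣ (p - 1) / semistabilityIndex W₁ p)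
    (hG₂ : TypeGOrd W₂ p) (hadd₂ : Addv W₂ p) (h2e₂ : 2 ∣ semistabilityIndex W₂ p)
    (he2₂ : semistabilityIndex W₂ p ≠ 2) (hodd₂ : ¬ 2 ∣ (p - 1) / semistabilityIndex W₂ p)
    (hRD₁ : RamifiedLineKummerEqAt W₁ p) (hRD₂ : RamifiedLineKummerEqAt W₂ p)
    (htors₁ : ¬ p ∣ W₁.torsionOrder)
    (hS₀ : ∀ v ∈ S₀, ((p : ℕ) : 𝓞 ℚ) ∉ v.asIdeal)
    (hS₁ : ∀ v : HeightOneSpectrum (𝓞 ℚ), v ∉ S₀ → ((p : ℕ) : 𝓞 ℚ) ∉ v.asIdeal →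
      W₁.HasGoodReductionAt v)
    (hS₂ : ∀ v : HeightOneSpectrum (𝓞 ℚ), v ∉ S₀ → ((p : ℕ) : 𝓞 ℚ) ∉ v.asIdeal →
      W₂.HasGoodReductionAt v)
    (hT : TorsionIso W₁ W₂ p) :
    Nat.card ((nonPrimitiveSelmerInfty W₁ κ S₀)[(p : ℤ)]) =
      Nat.card ((nonPrimitiveSelmerInfty W₂ κ S₀)[(p : ℤ)]) :=
  natCard_torsionBy_nonPrimitiveSelmerInfty_eq_of_matching κ S₀ (by omega) hκ
    (forall_exists_lines_matching_of_typeGOrd_of_even hp5 hG₁ hadd₁ h2e₁ he2₁ hodd₁ hG₂ hadd₂ h2e₂ he2₂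
      hodd₂)
    hRD₁ hRD₂ htors₁ hS₀ hS₁ hS₂ hT

/-- **`μ = 0` TRANSFER on a line-even Gord × Gord link** (`κ` cyclotomic with top generator `γ`; mod
hRD₁, hRD₂): if a f.g. non-primitive dual of the partner `E₁` is torsion with `μ = 0`, then EVERY
Selmer dual `D₂` of the receiver `E₂` is torsion with `μ = 0`.
[cite: GreenbergVatsal2000, §2 Prop. (2.8) and pp. 26–27] [cite: GreenbergLNM1716, Prop. 5.10 (p. 147)] -/
theorem selmer_isTorsion_and_mu_eq_zero_of_typeGOrd_typeGOrd_of_even (hp5 : 5 ≤ p)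
    (hκ : κ.IsCyclotomic) (hγ : κ.IsTopGenerator γ)
    (hG₁ : TypeGOrd W₁ p) (hadd₁ : Addv W₁ p) (h2e₁ : 2 ∣ semistabilityIndex W₁ p)
    (he2₁ : semistabilityIndex W₁ p ≠ 2) (hodd₁ : ¬ 2 ∣ (p - 1) / semistabilityIndex W₁ p)
    (hG₂ : TypeGOrd W₂ p) (hadd₂ : Addv W₂ p) (h2e₂ : 2 ∣ semistabilityIndex W₂ p)
    (he2₂ : semistabilityIndex W₂ p ≠ 2) (hodd₂ : ¬ 2 ∣ (p - 1) / semistabilityIndex W₂ p)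
    (hRD₁ : RamifiedLineKummerEqAt W₁ p) (hRD₂ : RamifiedLineKummerEqAt W₂ p)
    (htors₁ : ¬ p ∣ W₁.torsionOrder)
    (hS₀ : ∀ v ∈ S₀, ((p : ℕ) : 𝓞 ℚ) ∉ v.asIdeal)
    (hS₁ : ∀ v : HeightOneSpectrum (𝓞 ℚ), v ∉ S₀ → ((p : ℕ) : 𝓞 ℚ) ∉ v.asIdeal →
      W₁.HasGoodReductionAt v)
    (hS₂ : ∀ v : HeightOneSpectrum (𝓞 ℚ), v ∉ S₀ → ((p : ℕ) : 𝓞 ℚ) ∉ v.asIdeal →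
      W₂.HasGoodReductionAt v)
    (hT : TorsionIso W₁ W₂ p)
    (DS₁ : NonPrimitiveDualData W₁ κ γ S₀) [Module.Finite (IwasawaAlgebra p) DS₁.X]
    (ht₁ : Module.IsTorsion (IwasawaAlgebra p) DS₁.X) (hμ₁ : muInvariant p DS₁.X = 0)
    (D₂ : W₂.SelmerDualData κ γ) : D₂.IsTorsion ∧ D₂.mu = 0 :=
  selmer_isTorsion_and_mu_eq_zero_of_matching κ S₀ (by omega) hκ hγ
    (forall_exists_lines_matching_of_typeGOrd_of_even hp5 hG₁ hadd₁ h2e₁ he2₁ hodd₁ hG₂ hadd₂ h2e₂ he2₂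
      hodd₂)
    hRD₁ hRD₂ htors₁ hS₀ hS₁ hS₂ hT DS₁ ht₁ hμ₁ D₂

/-- **`λ(X^{Σ₀}_1) = λ(X^{Σ₀}_2)` on a line-even Gord × Gord link** (mod hRD₁, hRD₂; `hnf_i` the
no-finite-submodule binders as in p12's file), with the receiver's non-primitive dual torsion and
`μ = 0`. [cite: GreenbergVatsal2000, §2 Prop. (2.8) and pp. 26–27] -/
theorem nonPrimitive_lambdaInvariant_eq_of_typeGOrd_typeGOrd_of_even (hp5 : 5 ≤ p)
    (hκ : κ.IsCyclotomic)
    (hG₁ : TypeGOrd W₁ p) (hadd₁ : Addv W₁ p) (h2e₁ : 2 ∣ semistabilityIndex W₁ p)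
    (he2₁ : semistabilityIndex W₁ p ≠ 2) (hodd₁ : ¬ 2 ∣ (p - 1) / semistabilityIndex W₁ p)
    (hG₂ : TypeGOrd W₂ p) (hadd₂ : Addv W₂ p) (h2e₂ : 2 ∣ semistabilityIndex W₂ p)
    (he2₂ : semistabilityIndex W₂ p ≠ 2) (hodd₂ : ¬ 2 ∣ (p - 1) / semistabilityIndex W₂ p)
    (hRD₁ : RamifiedLineKummerEqAt W₁ p) (hRD₂ : RamifiedLineKummerEqAt W₂ p)
    (htors₁ : ¬ p ∣ W₁.torsionOrder)
    (hS₀ : ∀ v ∈ S₀, ((p : ℕ) : 𝓞 ℚ) ∉ v.asIdeal)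
    (hS₁ : ∀ v : HeightOneSpectrum (𝓞 ℚ), v ∉ S₀ → ((p : ℕ) : 𝓞 ℚ) ∉ v.asIdeal →
      W₁.HasGoodReductionAt v)
    (hS₂ : ∀ v : HeightOneSpectrum (𝓞 ℚ), v ∉ S₀ → ((p : ℕ) : 𝓞 ℚ) ∉ v.asIdeal →
      W₂.HasGoodReductionAt v)
    (hT : TorsionIso W₁ W₂ p)
    (DS₁ : NonPrimitiveDualData W₁ κ γ S₀) (DS₂ : NonPrimitiveDualData W₂ κ γ S₀)
    [Module.Finite (IwasawaAlgebra p) DS₁.X] [Module.Finite (IwasawaAlgebra p) DS₂.X]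
    (ht₁ : Module.IsTorsion (IwasawaAlgebra p) DS₁.X) (hμ₁ : muInvariant p DS₁.X = 0)
    (hnf₁ : ∀ N : Submodule (IwasawaAlgebra p) DS₁.X, Finite N → N = ⊥)
    (hnf₂ : ∀ N : Submodule (IwasawaAlgebra p) DS₂.X, Finite N → N = ⊥) :
    Module.IsTorsion (IwasawaAlgebra p) DS₂.X ∧ muInvariant p DS₂.X = 0 ∧
      lambdaInvariant p DS₁.X = lambdaInvariant p DS₂.X :=
  nonPrimitive_lambdaInvariant_eq_of_matching κ S₀ (by omega) hκ
    (forall_exists_lines_matching_of_typeGOrd_of_even hp5 hG₁ hadd₁ h2e₁ he2₁ hodd₁ hG₂ hadd₂ h2e₂ he2₂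
      hodd₂)
    hRD₁ hRD₂ htors₁ hS₀ hS₁ hS₂ hT DS₁ DS₂ ht₁ hμ₁ hnf₁ hnf₂

end Count

end GordEvenCongruentPairGV

end Summit.BirchSwinnertonDyer.Rank1Residual.Additive

end
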